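import Summits.QuantumFields.YangMills.Theorems.IR.BlockedActivityWOnset
import Summits.QuantumFields.YangMills.Theorems.IR.AfPincerUcSharpLanesTolerance
import HarnessLib

/-!
# Crux `IR` (stmt-QuantumFields-19354), lane B «strong coupling AFTER BLOCKING»: the R107∕R109-COMPLIANT form of the W|Typ construction statement
# (the supplier's `Typ` is NAMED per frame and INSERTION TOLERANT, `SharpLanes.InsertionTolerant`, p536427)

Helper module for item `stmt-QuantumFields-19354` (`--supports`; it closes nothing), lane `ym-19354-onsetsc-p2`.  Owner R107 (ctriage-1 O-118.1) ∕ R109: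
an I♯_SC supplier's typical class must tolerate the insertion of ONE short bad chain (`≤ ℓ₀` links) into a clean `R`-neighbourhood (`R ≤ b`), since at
asymptotically-free scales a typical collar CARRIES isolated short chains; the literal «re-set any `≤ ℓ₀` links» reading is degenerate
(`SharpLanes.eq_empty_or_univ_of_linkTolerant`).  Here the lane-B W|Typ statement of `Theorems/IR/BlockedActivityWOnset` is re-typed with that conjunct:

* `BlockedActivityTypOnsetCalSCWTol` — as `BlockedActivityTypOnsetCalSCW`, plus `β`-independent `ℓ₀ ≥ 1`, `R`, `θ` with `R ≤ b(β)` and, on every mesh-`b`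
  frame, `SharpLanes.InsertionTolerant r.ρ w θ R ℓ₀ Typ` for the supplied `Typ`;
* `blockedActivityTypOnsetCalSCW_of_tol` (forget the tolerance) and **`ir_of_blockedActivityTypOnsetCalSCWTol : … → SharpOnset.IRNSC → Theses.BalabanLadder.IR`**.
The located side-obligation R109 (4) (one-loop count: tolerate `ℓ₀ ≥ 6` at `b ≍ ξ`) is the supplier's to state; it is not a kernel binder here.

HONEST FRAMING: a re-typing of an OPEN construction statement of a CONDITIONAL chain with the supplier discipline of record; nothing is claimed about its
inhabitation; not mixing, not a gap, not Clay.  No `sorry`; axioms ⊆ {propext, Classical.choice, Quot.sound}.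
-/

set_option autoImplicit false

noncomputable section

open Filter Topology MeasureTheory
open Literature.MathematicalPhysics.QuantumFieldTheory Literature.MathematicalPhysics.QuantumLattice
open Summit.QuantumFields.YangMills.Cruxes.OSLegsFromFemtoAndGap.DlrCollarTransfer (LowerBounds)
open Summit.QuantumFields.YangMills.Cruxes.IR.OnsetFormats (shellCount)
open Summit.QuantumFields.YangMills.Cruxes.IR.AfPincerUc (IsFrame TypLocal ClauseIIukp ClauseIII)
open Summit.QuantumFields.YangMills.Cruxes.IR.AfPincerUc.SharpOnset (IRNSC)
open Summit.QuantumFields.YangMills.Cruxes.IR.AfPincerUc.SharpLanes (InsertionTolerant)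

namespace Summit.QuantumFields.YangMills.Cruxes.IR.BlockedActivity

/-- **Lane B, W|Typ, NT-calibrated, INSERTION TOLERANT (R107 ∕ R109-compliant)**: the hereditary construction statement with the supplier's `Typ`
named per frame and tolerant to one inserted short chain (`SharpLanes.InsertionTolerant r.ρ w θ R ℓ₀ Typ`, `1 ≤ ℓ₀`, `R ≤ b`, `ℓ₀, R, θ` fixed before `δ`).
OPEN research content; not asserted. -/
def BlockedActivityTypOnsetCalSCWTol : Prop :=
  ∀ (G : Type) [Group G] [TopologicalSpace G] [IsTopologicalGroup G] [CompactSpace G],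
    IsCompactSimpleLieGroup G → SimplyConnectedSpace G →
    letI : MeasurableSpace G := borel G; haveI : BorelSpace G := ⟨rfl⟩;
    ∀ (r : LatticeRep G) (a : ℝ → ℝ), (∀ β, 0 < a β) → Tendsto a atTop (𝓝 0) → LowerBounds G r a →
      ∃ (n : ℕ) (ε : ℝ), 1 ≤ n ∧ 0 ≤ ε ∧ ε * shellCount n ≤ 3 / 4 ∧
        ∃ (ℓ₀ R : ℕ) (θ : ℝ), 1 ≤ ℓ₀ ∧
          ∀ δ : ℝ, 0 < δ → ∃ T β₂ : ℝ, ∀ β : ℝ, β₂ ≤ β → ∃ b : ℕ, 1 ≤ b ∧ a β * (b : ℝ) < T ∧ R ≤ b ∧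
            ∀ w : Fin 4 → ℤ → ℤ, IsFrame b w → ∃ Typ : (Fin 4 → ℤ) → Set (LGConfig 4 G),
              TypLocal w Typ ∧ InsertionTolerant r.ρ w θ R ℓ₀ Typ ∧ BlockedActivityTypWAll r.ρ β w n (radiusT ε) Typ ∧
                ClauseIIukp r.ρ β w δ Typ ∧ ClauseIII r.ρ β w b δ Typ

/-- Forgetting the tolerance conjunct gives the W|Typ statement of `Theorems/IR/BlockedActivityWOnset`. -/
theorem blockedActivityTypOnsetCalSCW_of_tol (h : BlockedActivityTypOnsetCalSCWTol) : BlockedActivityTypOnsetCalSCW := by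
  intro G _ _ _ _ hG hsc
  letI : MeasurableSpace G := borel G
  haveI : BorelSpace G := ⟨rfl⟩
  intro r a ha hat hlb
  obtain ⟨n, ε, hn, hε, hM, ℓ₀, R, θ, -, hrest⟩ := h G hG hsc r a ha hat hlb
  refine ⟨n, ε, hn, hε, hM, fun δ hδ => ?_⟩
  obtain ⟨T, β₂, hβ⟩ := hrest δ hδ
  refine ⟨T, β₂, fun β hb => ?_⟩
  obtain ⟨b, hb1, hlt, -, hw⟩ := hβ β hb
  refine ⟨b, hb1, hlt, fun w hwf => ?_⟩
  obtain ⟨Typ, hloc, -, hact, hii, hiii⟩ := hw w hwf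
  exact ⟨Typ, hloc, hact, hii, hiii⟩

/-- **R107∕R109-compliant W|Typ lane-B statement ∧ R_NSC ⇒ the route decl `IR`** (no X-stub). -/
theorem ir_of_blockedActivityTypOnsetCalSCWTol (h : BlockedActivityTypOnsetCalSCWTol) (hN : IRNSC) :
    Summit.QuantumFields.YangMills.Theses.BalabanLadder.IR :=
  ir_of_blockedActivityTypOnsetCalSCW (blockedActivityTypOnsetCalSCW_of_tol h) hN

/-! ## The GUARDED twin (owner R118 (2), ctriage-1 S-142)

ctriage-1 S-142 (kernel `S105.tol_iff_calSCW`): AS TYPED above, `θ` and `R` are free, and the witness `(ℓ₀, R, θ) = (1, 0, −1)` makes the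
premise `plaqAction ≤ θ` of `InsertionTolerant` unsatisfiable, so `BlockedActivityTypOnsetCalSCWTol ↔ BlockedActivityTypOnsetCalSCW` — the tolerance
conjunct is vacuous.  Owner R118 (2): every twin proposed as a currency carries the guard `1 ≤ ℓ₀ ∧ 3 ≤ R ∧ 0 < θ` in that binder (`R ≥ 3`
matches `insertionTolerant_typChain` ∕ `insertionTolerantOwn_typChain`, p537603 ∕ p539933; `θ > 0` is a genuine plaquette-action level).  The guarded
decl and its three reductions, verbatim otherwise. -/

/-- **Lane B, W|Typ, NT-calibrated, insertion tolerant — GUARDED (owner R118 (2) ∕ S-142)**: as `BlockedActivityTypOnsetCalSCWTol` with the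
binder `∃ ℓ₀ R θ` guarded by `1 ≤ ℓ₀ ∧ 3 ≤ R ∧ 0 < θ` (so the tolerance conjunct is NOT vacuous: a clean `R`-neighbourhood, `R ≥ 3`, at a
positive action level `θ`).  The lane-B supplier target of record in its R118-amended reading.  OPEN research content; not asserted. -/
def BlockedActivityTypOnsetCalSCWTolG : Prop :=
  ∀ (G : Type) [Group G] [TopologicalSpace G] [IsTopologicalGroup G] [CompactSpace G],
    IsCompactSimpleLieGroup G → SimplyConnectedSpace G →
    letI : MeasurableSpace G := borel G; haveI : BorelSpace G := ⟨rfl⟩;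
    ∀ (r : LatticeRep G) (a : ℝ → ℝ), (∀ β, 0 < a β) → Tendsto a atTop (𝓝 0) → LowerBounds G r a →
      ∃ (n : ℕ) (ε : ℝ), 1 ≤ n ∧ 0 ≤ ε ∧ ε * shellCount n ≤ 3 / 4 ∧
        ∃ (ℓ₀ R : ℕ) (θ : ℝ), 1 ≤ ℓ₀ ∧ 3 ≤ R ∧ 0 < θ ∧
          ∀ δ : ℝ, 0 < δ → ∃ T β₂ : ℝ, ∀ β : ℝ, β₂ ≤ β → ∃ b : ℕ, 1 ≤ b ∧ a β * (b : ℝ) < T ∧ R ≤ b ∧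
            ∀ w : Fin 4 → ℤ → ℤ, IsFrame b w → ∃ Typ : (Fin 4 → ℤ) → Set (LGConfig 4 G),
              TypLocal w Typ ∧ InsertionTolerant r.ρ w θ R ℓ₀ Typ ∧ BlockedActivityTypWAll r.ρ β w n (radiusT ε) Typ ∧
                ClauseIIukp r.ρ β w δ Typ ∧ ClauseIII r.ρ β w b δ Typ

/-- The guarded statement implies the unguarded one (forget `3 ≤ R ∧ 0 < θ`). -/
theorem blockedActivityTypOnsetCalSCWTol_of_tolG (h : BlockedActivityTypOnsetCalSCWTolG) : BlockedActivityTypOnsetCalSCWTol := by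
  intro G _ _ _ _ hG hsc
  letI : MeasurableSpace G := borel G
  haveI : BorelSpace G := ⟨rfl⟩
  intro r a ha hat hlb
  obtain ⟨n, ε, hn, hε, hM, ℓ₀, R, θ, hℓ, -, -, hrest⟩ := h G hG hsc r a ha hat hlb
  exact ⟨n, ε, hn, hε, hM, ℓ₀, R, θ, hℓ, hrest⟩

/-- Forgetting the (guarded) tolerance conjunct gives the W|Typ statement of `Theorems/IR/BlockedActivityWOnset`. -/
theorem blockedActivityTypOnsetCalSCW_of_tolG (h : BlockedActivityTypOnsetCalSCWTolG) : BlockedActivityTypOnsetCalSCW :=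
  blockedActivityTypOnsetCalSCW_of_tol (blockedActivityTypOnsetCalSCWTol_of_tolG h)

/-- **GUARDED R107∕R109∕R118-compliant W|Typ lane-B statement ∧ R_NSC ⇒ the route decl `IR`** (no X-stub). -/
theorem ir_of_blockedActivityTypOnsetCalSCWTolG (h : BlockedActivityTypOnsetCalSCWTolG) (hN : IRNSC) :
    Summit.QuantumFields.YangMills.Theses.BalabanLadder.IR :=
  ir_of_blockedActivityTypOnsetCalSCWTol (blockedActivityTypOnsetCalSCWTol_of_tolG h) hN

end Summit.QuantumFields.YangMills.Cruxes.IR.BlockedActivity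

end
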